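import Mathlib
import Summits.NavierStokesRegularity.OSWSelfSimilar.SheetNSLineTorusCascadeCellCheckerRun
import Summits.NavierStokesRegularity.OSWSelfSimilar.SheetNSLineTorusCascadeCellChunks
import HarnessLib

/-!
# Viscous CLM on the torus (`a = 0`, `σ = 2`): the reflective cell-chain checker — run for a BRACKETED REAL DATUM, ray, and
# THE USER-FACING THEOREM `runB_sound`

HONEST FRAMING (cell ns-blowup GROUP B «PROFILE SEARCH», zone Z3, row Z3-U addendum A-F2 of `HOME/profile/z3/CENSUS-Z3.md`;
human rulings D-0035/D-0074; Z3-TWIN lineage, eng-5 g13): **1-D MODEL (viscous Constantin–Lax–Majda equation `ω_t = ω Hω + ν ω_xx`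
on `𝕋`); natural-number arithmetic + ODE comparison, kernel-checked; not Euler, not Navier–Stokes; «violates: none — MODEL».**

* for `initB` / `runB` (the run for a REAL datum `c` bracketed by `xlo₀ ≤ 2^P c ≤ xhi₀`) and `xloAfter` / `powUp` of
  `SheetNSLineTorusCascadeCellChunks`: `xloAfter_le`, `le_powUp`, `mode_one_ge_xloAfter`, `exp_neg_le_powUp` — dyadic bounds for
  mode `1` on a window and for `e^{−nδ}`, so that instance files never meet `exp` or large powers;
* `initB_inv`, `runAll_rest_sound`, `runAll_sound` — the invariant `Inv` of `SheetNSLineTorusCascadeCellCheckerRun` from `t = 0`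
  through all segments; `rayLoop_sound` — the ray envelopes bound the modes on `[t_end, ∞)` (`ray_ub_readout`);
* **`runB_sound`** / `run_sound` — for a sine cascade `IsSineCascade 1 c e`, segments `⟨a, j, n⟩` with `0 < a < 2^j`, a window
  `w₁ < w₂ ≤ n₁` of cells of the first segment, and `CellChain.runB P K xlo₀ xhi₀ B w₁ w₂ segs = (U, L)` (evaluated by the
  kernel): **`e_k(s) ≤ U[k−2]/2^P` for all `s ≥ 0` and `L[k−2]/2^P ≤ e_k(s)` for `s ∈ [w₁ δ₁, w₂ δ₁]`, `δ₁ = log(2^{j₁}/a₁)`,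
  `2 ≤ k ≤ K`.** USE: with `c` = a candidate threshold and `e = (k, t) ↦ c^k E_k(t)` (`IsSineCascade.smul_pow`), the closing
  theorems `family_lower_bound_at` (blow-up) and `super_tail_induction` (global existence) apply to `e` with `λ = 1` / `β = 1`,
  so every closing inequality is between dyadic rationals.
bears_on: LADDER-NS N5 / zone Z3 (row Z3-U) → N1 linear core. WHAT THIS IS NOT: not NS; no number certified by THIS file.
-/

namespace Summit.NavierStokesRegularity.OSWSelfSimilar
namespace SheetNSLineTorusCascade
namespace CellChain

open Finset Real Set

section Run

variable {c : ℝ} {e : ℕ → ℝ → ℝ}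

/-- `xloAfter` is a lower bound: `x/D ≤ y` ⇒ `xloAfter a j n x / D ≤ y·(a/2^j)^n` (`y ≥ 0`). [new here — MODEL] -/
theorem xloAfter_le {a j : ℕ} {D : ℝ} (hD : 0 < D) :
    ∀ (n x : ℕ) (y : ℝ), 0 ≤ y → (x : ℝ) / D ≤ y → (xloAfter a j n x : ℝ) / D ≤ y * ((a : ℝ) / 2 ^ j) ^ n
  | 0, x, y, _, h => by simpa [xloAfter] using h
  | n + 1, x, y, hy, h => by
    rw [xloAfter, pow_succ', ← mul_assoc]
    refine xloAfter_le hD n _ (y * ((a : ℝ) / 2 ^ j)) (by positivity) ?_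
    have h1 : (((x * a) >>> j : ℕ) : ℝ) ≤ ((x * a : ℕ) : ℝ) / ((2 ^ j : ℕ) : ℝ) := by
      rw [Nat.shiftRight_eq_div_pow]; exact Nat.cast_div_le
    rw [div_le_iff₀ hD] at h ⊢
    push_cast at h1 ⊢
    have h3 : (x : ℝ) * a / 2 ^ j ≤ y * D * (a / 2 ^ j) := by
      rw [mul_div_assoc]; exact mul_le_mul_of_nonneg_right h (by positivity)
    linarith

/-- `powUp` is an upper bound: `y ≤ x/D` ⇒ `y·(a/2^j)^n ≤ powUp a j n x / D` (`y ≥ 0`). [new here — MODEL] -/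
theorem le_powUp {a j : ℕ} {D : ℝ} (hD : 0 < D) :
    ∀ (n x : ℕ) (y : ℝ), 0 ≤ y → y ≤ (x : ℝ) / D → y * ((a : ℝ) / 2 ^ j) ^ n ≤ (powUp a j n x : ℝ) / D
  | 0, x, y, _, h => by simpa [powUp] using h
  | n + 1, x, y, hy, h => by
    rw [powUp, pow_succ', ← mul_assoc]
    refine le_powUp hD n _ (y * ((a : ℝ) / 2 ^ j)) (by positivity) ?_
    have h1 : ((x * a : ℕ) : ℝ) / ((2 ^ j : ℕ) : ℝ) ≤ ((cdiv (x * a) (2 ^ j) : ℕ) : ℝ) := (cdiv_spec _ (by positivity)).2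
    rw [le_div_iff₀ hD] at h ⊢
    push_cast at h1 ⊢
    have h3 : y * D * (a / 2 ^ j) ≤ (x : ℝ) * a / 2 ^ j := by
      rw [mul_div_assoc]; exact mul_le_mul_of_nonneg_right h (by positivity)
    have h4 : (x : ℝ) * a / 2 ^ j ≤ (cdiv (x * a) (2 ^ j) : ℝ) := h1
    nlinarith

/-- **Mode one on the window, from the datum bracket:** if `xlo₀/2^P ≤ c` (`c ≥ 0`) then for every `s ∈ [0, n·log(2^j/a)]`
(`0 < a`): `xloAfter a j n xlo₀ / 2^P ≤ c·e^{−s} = e_1(s)`. [new here — MODEL] -/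
theorem mode_one_ge_xloAfter (he : IsSineCascade 1 c e) (hc : 0 ≤ c) {P xlo₀ a j n : ℕ} (ha : 0 < a)
    (hx : (xlo₀ : ℝ) / 2 ^ P ≤ c) {s : ℝ} (hs : s ∈ Icc 0 ((n : ℝ) * Real.log (2 ^ j / a))) :
    (xloAfter a j n xlo₀ : ℝ) / 2 ^ P ≤ e 1 s := by
  have har : (0 : ℝ) < a := by exact_mod_cast ha
  have h := xloAfter_le (a := a) (j := j) (D := (2 : ℝ) ^ P) (by positivity) n xlo₀ c hc hx
  rw [← exp_neg_mul_log_dyadic n har j] at h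
  rw [mode_one he s hs.1]
  exact le_trans h (mul_le_mul_of_nonneg_left (exp_le_exp.mpr (by linarith [hs.2])) hc)

/-- **A dyadic upper bound for `e^{−n·log(2^j/a)}`** (`0 < a`): `≤ powUp a j n (2^P) / 2^P`. [new here — MODEL] -/
theorem exp_neg_le_powUp (P : ℕ) {a : ℕ} (ha : 0 < a) (j n : ℕ) :
    exp (-((n : ℝ) * Real.log (2 ^ j / a))) ≤ (powUp a j n (2 ^ P) : ℝ) / 2 ^ P := by
  have har : (0 : ℝ) < a := by exact_mod_cast ha
  have h := le_powUp (a := a) (j := j) (D := (2 : ℝ) ^ P) (by positivity) n (2 ^ P) 1 zero_le_one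
    (by rw [le_div_iff₀ (by positivity)]; push_cast; simp)
  rw [exp_neg_mul_log_dyadic n har j]
  simpa using h

/-- **The initial state satisfies the invariant** at `t = 0` (`e_1(0) = c ∈ [xlo₀/D, xhi₀/D]`, `e_k(0) = 0` for `k ≥ 2`).
[new here — MODEL] -/
theorem initB_inv (he : IsSineCascade 1 c e) (P K B w₁ w₂ : ℕ) {xlo₀ xhi₀ : ℕ}
    (hlo : (xlo₀ : ℝ) / ((2 ^ P : ℕ) : ℝ) ≤ c) (hhi : c ≤ (xhi₀ : ℝ) / ((2 ^ P : ℕ) : ℝ)) (δ₁ : ℝ) :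
    Inv e c P K w₁ w₂ δ₁ 0 (initB K xlo₀ xhi₀ B) := by
  have hz : ∀ k, 2 ≤ k → e k 0 = 0 := fun k hk => he.init_zero k hk
  refine ⟨le_rfl, ?_, ?_, ?_, ?_, ?_, ?_, ?_, Or.inl (by simp [initB]), fun h => absurd h (by simp [initB])⟩
  · simpa [initB] using hlo
  · simpa [initB] using hhi
  · simp only [initB, zeros_eq_consts]
    exact IForall₂_consts (k₀ := 2) (fun k hk => by rw [hz k hk]; simp) _ _ le_rfl
  · simp [initB, zeros_eq_consts, length_consts]
  · simp only [initB, zeros_eq_consts]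
    refine IForall_consts (k₀ := 2) (fun k hk s hs => ?_) _ _ le_rfl
    obtain rfl : s = 0 := le_antisymm hs.2 hs.1
    rw [hz k hk]; simp
  · simp [initB, zeros_eq_consts, length_consts]
  · simp [initB, length_consts]

/-- **The remaining segments** (window already over) preserve the invariant. [new here — MODEL] -/
theorem runAll_rest_sound (he : IsSineCascade 1 c e) (hc : 0 ≤ c) {P K w₁ w₂ : ℕ} (hw : w₁ < w₂) {δ₁ : ℝ} (hδ₁ : 0 ≤ δ₁) :
    ∀ (segs : List Seg) (t : ℝ) (st : St), (∀ sg ∈ segs, 0 < sg.a ∧ sg.a < 2 ^ sg.j) →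
      Inv e c P K w₁ w₂ δ₁ t st → ((w₂ : ℝ) * δ₁ ≤ t ∧ w₂ ≤ st.idx) →
      ∃ t', ((w₂ : ℝ) * δ₁ ≤ t' ∧ w₂ ≤ (runAll P K w₁ w₂ segs st).idx) ∧ Inv e c P K w₁ w₂ δ₁ t' (runAll P K w₁ w₂ segs st)
  | [], t, st, _, hI, hm => ⟨t, ⟨hm.1, hm.2⟩, hI⟩
  | sg :: segs, t, st, hv, hI, hm => by
    have hsg := hv sg (by simp)
    have hseg := runSeg_sound he hc hw hδ₁ hsg.1 hsg.2 sg.n t st hI (Or.inr hm)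
    have har : (0 : ℝ) < sg.a := by exact_mod_cast hsg.1
    have hδ0 : 0 ≤ Real.log (2 ^ sg.j / sg.a) := log_dyadic_nonneg har sg.j (by exact_mod_cast hsg.2.le)
    rw [runAll]
    exact runAll_rest_sound he hc hw hδ₁ segs _ _ (fun sg' h => hv sg' (by simp [h])) hseg.1
      ⟨by nlinarith [hm.1], by rw [hseg.2]; omega⟩

/-- **All segments** from the initial state: the invariant at some final time `t' ≥ w₂ δ₁` with the window over. [new here — MODEL] -/
theorem runAll_sound (he : IsSineCascade 1 c e) (hc : 0 ≤ c) {P K B w₁ w₂ xlo₀ xhi₀ : ℕ} (hw : w₁ < w₂) {sg : Seg}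
    {segs : List Seg} (hwn : w₂ ≤ sg.n) (hv : ∀ s ∈ sg :: segs, 0 < s.a ∧ s.a < 2 ^ s.j)
    (hlo : (xlo₀ : ℝ) / ((2 ^ P : ℕ) : ℝ) ≤ c) (hhi : c ≤ (xhi₀ : ℝ) / ((2 ^ P : ℕ) : ℝ)) :
    ∃ t', ((w₂ : ℝ) * Real.log (2 ^ sg.j / sg.a) ≤ t' ∧ w₂ ≤ (runAll P K w₁ w₂ (sg :: segs) (initB K xlo₀ xhi₀ B)).idx) ∧
      Inv e c P K w₁ w₂ (Real.log (2 ^ sg.j / sg.a)) t' (runAll P K w₁ w₂ (sg :: segs) (initB K xlo₀ xhi₀ B)) := by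
  have hsg := hv sg (by simp)
  have har : (0 : ℝ) < sg.a := by exact_mod_cast hsg.1
  have hδ0 : 0 ≤ Real.log (2 ^ sg.j / sg.a) := log_dyadic_nonneg har sg.j (by exact_mod_cast hsg.2.le)
  have h1 := runSeg_sound he hc hw hδ0 hsg.1 hsg.2 sg.n 0 (initB K xlo₀ xhi₀ B) (initB_inv he P K B w₁ w₂ hlo hhi _)
    (Or.inl rfl)
  rw [runAll]
  refine runAll_rest_sound he hc hw hδ0 segs _ _ (fun sg' h => hv sg' (by simp [h])) h1.1 ⟨?_, ?_⟩
  · rw [zero_add]; exact mul_le_mul_of_nonneg_right (by exact_mod_cast hwn) hδ0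
  · rw [h1.2]; simp [initB]; exact hwn

/-- **The ray is honest.** With an upper table of the modes `< k` valid on `[t_f, ∞)` and start values `e_k(t_f) ≤ u/D`, the ray
envelopes bound the modes `k, k+1, …` on `[t_f, ∞)`. [new here — MODEL] -/
theorem rayLoop_sound (he : IsSineCascade 1 c e) (hc : 0 ≤ c) {D : ℕ} (hD : 0 < D) {tf : ℝ} (htf : 0 ≤ tf) :
    ∀ (ups : List ℕ) (k : ℕ) (MF MR : List ℕ), 1 ≤ k → MR = MF.reverse → MF.length + 1 = k →
      (∀ b, 1 ≤ b → b < k → ∀ σ, tf ≤ σ → e b σ ≤ (lget MF b : ℝ) / D) →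
      IForall (fun k u => e k tf ≤ (u : ℝ) / D) k ups →
      IForall (fun k M => ∀ σ, tf ≤ σ → e k σ ≤ (M : ℝ) / D) k (rayLoop D ups k MF MR) ∧
        (rayLoop D ups k MF MR).length = ups.length
  | [], k, MF, MR, _, _, _, _, _ => ⟨trivial, rfl⟩
  | u :: ups, k, MF, MR, hk, hMR, hlen, htab, hups => by
    have hDr : (0 : ℝ) < D := by exact_mod_cast hD
    have hkpos : (0 : ℝ) < k := by exact_mod_cast hk
    have hkk : 0 < 2 * D * k * k := by positivity
    set Φk : ℕ := cdiv (dot MF MR) (2 * D * k * k) with hΦk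
    -- the convolution upper bound on the ray, from the table (lower table = zeros)
    have hconv : ∀ σ, tf ≤ σ → ∑ p ∈ antidiagonal k, e p.1 σ * e p.2 σ ≤ (dot MF MR : ℝ) / (D : ℝ) ^ 2 := by
      intro σ hσ
      have hInTab : InTab e D tf σ k (consts 0 (k - 1)) MF := by
        refine ⟨by rw [length_consts]; omega, hlen, fun b hb1 hbk s hs => ⟨?_, htab b hb1 hbk s hs.1⟩⟩
        rw [lget_consts_zero]; simp only [Nat.cast_zero, zero_div]
        exact nonneg he hc b s (le_trans htf hs.1)
      have := (conv_bounds he hc hD htf hInTab (σ := σ) ⟨hσ, le_rfl⟩).2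
      rwa [hMR]
    have hΦ' : (1 / 2 * ((dot MF MR : ℝ) / (D : ℝ) ^ 2)) / (1 * (k : ℝ) ^ 2) ≤ (Φk : ℝ) / D := by
      have h1 : (dot MF MR : ℝ) / ((2 * D * k * k : ℕ) : ℝ) ≤ (Φk : ℝ) := (cdiv_spec _ hkk).2
      rw [le_div_iff₀ hDr]
      refine le_trans (le_of_eq ?_) h1
      push_cast
      field_simp
    have hray := ray_ub_readout he one_pos hk htf hups.1 (Φ := 1 / 2 * ((dot MF MR : ℝ) / (D : ℝ) ^ 2))
      (fun σ hσ => by have := hconv σ hσ; linarith) hΦ'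
    have hM : ∀ σ, tf ≤ σ → e k σ ≤ ((max u Φk : ℕ) : ℝ) / D := by
      intro σ hσ
      rw [Nat.cast_max, ← max_div_div_right hDr.le]
      exact hray σ hσ
    have htab' : ∀ b, 1 ≤ b → b < k + 1 → ∀ σ, tf ≤ σ → e b σ ≤ (lget (MF ++ [max u Φk]) b : ℝ) / D := by
      intro b hb1 hbk σ hσ
      rcases Nat.lt_or_ge b k with hbk' | hbk'
      · rw [lget_append_left _ _ (by omega)]; exact htab b hb1 hbk' σ hσ
      · obtain rfl : b = k := by omega
        rw [show b = MF.length + 1 by omega, lget_append_length_succ, show MF.length + 1 = b by omega]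
        exact hM σ hσ
    have ih := rayLoop_sound he hc hD htf ups (k + 1) (MF ++ [max u Φk]) (max u Φk :: MR) (by omega) (by simp [hMR])
      (by simp; omega) htab' hups.2
    simp only [rayLoop, List.length_cons]
    exact ⟨⟨hM, ih.1⟩, congrArg (· + 1) ih.2⟩

/-- **THE USER-FACING THEOREM (bracketed real datum).** Let `P, K, B, w₁, w₂, xlo₀, xhi₀ ∈ ℕ`, segments `sg :: segs` with
`0 < a < 2^j` each, a window `w₁ < w₂ ≤ sg.n` of cells of the first segment (cell length `δ₁ = log(2^{sg.j}/sg.a)`), a real datum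
`xlo₀/2^P ≤ c ≤ xhi₀/2^P`, and suppose the KERNEL evaluated `runB P K xlo₀ xhi₀ B w₁ w₂ (sg :: segs) = (U, L)`. Then for every
sine cascade `IsSineCascade 1 c e` and every mode `2 ≤ i + 2 ≤ K`: `e_{i+2}(s) ≤ U[i]/2^P` for all `s ≥ 0`, and
`L[i]/2^P ≤ e_{i+2}(s)` for `s ∈ [w₁ δ₁, w₂ δ₁]`. [new here — MODEL] -/
theorem runB_sound {P K B w₁ w₂ xlo₀ xhi₀ : ℕ} {sg : Seg} {segs : List Seg} (hK : 2 ≤ K) (hw : w₁ < w₂) (hwn : w₂ ≤ sg.n)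
    (hv : ∀ s ∈ sg :: segs, 0 < s.a ∧ s.a < 2 ^ s.j) {U L : List ℕ}
    (hrun : runB P K xlo₀ xhi₀ B w₁ w₂ (sg :: segs) = (U, L)) {c : ℝ} (hlo : (xlo₀ : ℝ) / 2 ^ P ≤ c)
    (hhi : c ≤ (xhi₀ : ℝ) / 2 ^ P) {e : ℕ → ℝ → ℝ} (he : IsSineCascade 1 c e) :
    (∀ i, i + 2 ≤ K → ∀ s, 0 ≤ s → e (i + 2) s ≤ (U.getD i 0 : ℝ) / 2 ^ P) ∧
    (∀ i, i + 2 ≤ K → ∀ s ∈ Icc ((w₁ : ℝ) * Real.log (2 ^ sg.j / sg.a)) ((w₂ : ℝ) * Real.log (2 ^ sg.j / sg.a)),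
      (L.getD i 0 : ℝ) / 2 ^ P ≤ e (i + 2) s) := by
  have hcast : ((2 ^ P : ℕ) : ℝ) = (2 : ℝ) ^ P := by push_cast; ring
  have hc : 0 ≤ c := le_trans (by positivity) hlo
  obtain ⟨t', ⟨hT₂, hidx⟩, hI⟩ := runAll_sound he hc (P := P) (K := K) (B := B) (xlo₀ := xlo₀) (xhi₀ := xhi₀) hw hwn hv
    (by rw [hcast]; exact hlo) (by rw [hcast]; exact hhi)
  set st := runAll P K w₁ w₂ (sg :: segs) (initB K xlo₀ xhi₀ B) with hst
  have hD : 0 < 2 ^ P := by positivity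
  have hDr : (0 : ℝ) < ((2 ^ P : ℕ) : ℝ) := by positivity
  simp only [runB] at hrun
  rw [← hst] at hrun
  obtain ⟨rfl, rfl⟩ := Prod.mk.injEq _ _ _ _ |>.mp hrun
  -- the ray
  have hray := rayLoop_sound he hc hD hI.t0 st.up 2 [st.xhi] [st.xhi] (by norm_num) rfl rfl
    (fun b hb1 hb2 σ hσ => by
      obtain rfl : b = 1 := by omega
      simp only [lget_succ, List.getD_cons_zero]
      have hm := (mode_one_bounds he zero_le_one hc hI.t0 (t₁ := σ) (s := σ) ⟨hσ, le_rfl⟩).2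
      exact le_trans hm hI.xhi)
    (IForall₂.snd (fun k x y hxy => hxy.2) _ _ 2 hI.heads)
  have hlenup : st.up.length = K - 1 := by rw [← IForall₂.length_eq _ _ 2 hI.heads, hI.lenlo]
  have hU := IForall.zipMax (P := fun k U => ∀ s ∈ Icc 0 t', e k s ≤ (U : ℝ) / ((2 ^ P : ℕ) : ℝ))
    (Q := fun k M => ∀ σ, t' ≤ σ → e k σ ≤ (M : ℝ) / ((2 ^ P : ℕ) : ℝ))
    (R := fun k U => ∀ s, 0 ≤ s → e k s ≤ (U : ℝ) / ((2 ^ P : ℕ) : ℝ))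
    (fun k x y hx hy s hs => by
      rw [Nat.cast_max, ← max_div_div_right hDr.le]
      rcases le_total s t' with hst' | hst'
      · exact le_trans (hx s ⟨hs, hst'⟩) (le_max_left _ _)
      · exact le_trans (hy s hst') (le_max_right _ _))
    st.usup _ 2 hI.sup hray.1 (by rw [hI.lensup, hray.2, hlenup])
  have hwin := hI.win (by omega)
  rw [min_eq_right hT₂] at hwin
  constructor
  · intro i hi s hs
    have h := IForall.getD _ 2 hU.1 i (by rw [hU.2, hI.lensup]; omega) s hs
    rw [hcast] at h
    simpa [add_comm] using h
  · intro i hi s hs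
    have h := IForall.getD _ 2 hwin i (by rw [hI.leninf]; omega) s hs
    rw [hcast] at h
    simpa [add_comm] using h

/-- **The same for a natural datum `c₀`** (`run = runB` with the exact bracket). [new here — MODEL] -/
theorem run_sound {P K c₀ B w₁ w₂ : ℕ} {sg : Seg} {segs : List Seg} (hK : 2 ≤ K) (hw : w₁ < w₂) (hwn : w₂ ≤ sg.n)
    (hv : ∀ s ∈ sg :: segs, 0 < s.a ∧ s.a < 2 ^ s.j) {U L : List ℕ}
    (hrun : run P K c₀ B w₁ w₂ (sg :: segs) = (U, L)) {e : ℕ → ℝ → ℝ} (he : IsSineCascade 1 (c₀ : ℝ) e) :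
    (∀ i, i + 2 ≤ K → ∀ s, 0 ≤ s → e (i + 2) s ≤ (U.getD i 0 : ℝ) / 2 ^ P) ∧
    (∀ i, i + 2 ≤ K → ∀ s ∈ Icc ((w₁ : ℝ) * Real.log (2 ^ sg.j / sg.a)) ((w₂ : ℝ) * Real.log (2 ^ sg.j / sg.a)),
      (L.getD i 0 : ℝ) / 2 ^ P ≤ e (i + 2) s) := by
  rw [run_eq_runB] at hrun
  have h : ((c₀ * 2 ^ P : ℕ) : ℝ) / 2 ^ P = c₀ := by push_cast; field_simp
  exact runB_sound hK hw hwn hv hrun h.le h.ge he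

end Run

end CellChain
end SheetNSLineTorusCascade
end Summit.NavierStokesRegularity.OSWSelfSimilar
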